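import Summits.NavierStokesRegularity.NavierStokesRegularity.Theses.RecurrentProfiles

/-!
# Route RecurrentProfiles — support glue `TargetOfCruxes`

Item stmt-NavierStokesRegularity-1593. Pure logic: the two cruxes of the route,
`RecurrentLiouville` (a uniformly recurrent Type-I-rate profile of the local-energy class is regular
at the origin) and `RecurrentReduction` (an origin-singular profile of the class yields a uniformly
recurrent origin-singular profile of the class with the same rate constant), imply the target
`NoTypeIRateProfile` (no profile of the class is singular at the origin). All three hypotheses are
inlined verbatim in the route decl `TargetOfCruxes`.
-/

set_option linter.dupNamespace false

namespace Summit.NavierStokesRegularity.NavierStokesRegularity.Theorems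

/-- The support glue of route RecurrentProfiles holds: given the recurrent Liouville theorem and
the reduction to recurrent profiles, no local-energy Type-I-rate profile is singular at the
space–time origin. Proof: a singular class profile `u` is reduced to a uniformly recurrent singular
class profile `w` (same rate constant `C`), which the Liouville hypothesis declares regular at the
origin — contradiction. -/
theorem recurrentProfiles_targetOfCruxes_proof :
    Summit.NavierStokesRegularity.NavierStokesRegularity.Theses.RecurrentProfiles.TargetOfCruxes := by
  unfold Summit.NavierStokesRegularity.NavierStokesRegularity.Theses.RecurrentProfiles.TargetOfCruxes
  intro h2 h1 u p G C hsw hgr hIb hdec hsing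
  obtain ⟨w, q, H, hsw', hgr', hIb', hdec', hsing', hrec'⟩ := h1 u p G C hsw hgr hIb hdec hsing
  exact h2 w q H C hsw' hgr' hIb' hdec' hrec' hsing'

end Summit.NavierStokesRegularity.NavierStokesRegularity.Theorems
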